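import Summits.AtomisticToContinuum.Crystallization.Theorems.FrustratedLawDichotomyStrainedPatchHomCurvLeaf2

/-!
# The label box of the curvature/slope leaves IS the `(H)` certificate's index box, and labels off the near list are FAR

decomp-a2c hand-1 g26 (crux `AperiodicFrustratedLawGap`, stmt-AtomisticToContinuum-27623; `λ`-leaf of lever (C)).  Two bookkeeping facts the final
ξ-elimination leaf needs in order to speak about the `hver`'s B-family sum over `Fintype.piFinset (Icc (−7) 7)`:

* ★ `boxLabels7_toFinset` — the in-kernel label list `boxLabels7` of `…HomCurvLeaf2` enumerates exactly the index box `[−7, 7]³` (its `Nodup`,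
  needed for `L.toFinset` sums, is left to the successor: `decide +kernel` on 3375 `Fin 3 → ℤ` labels does not go through);
* ★ `far_of_not_near` — a label REJECTED by the kernel filter `nearLabels c w r2n r2d` (squared-radius enclosure not below `r2n/r2d`) has
  `r2n/r2d ≤ ‖latPt U hexFrame b + U(hcpShift + ξ)‖²` for every `(U, ξ)` of the box (so with `r2n/r2d > (9/2)²` its `W₄₅`, `W₄₅′`, `W₄₅″` terms vanish).

NO definitions; 0 sorry; standard axioms; no instances / notation / `#eval`.  `--supports stmt-AtomisticToContinuum-27623`.
-/

noncomputable section

namespace Summit.AtomisticToContinuum.Crystallization.Theorems.FrustratedLawDichotomyStrainedPatchHomCurvLeaf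

open scoped BigOperators RealInnerProductSpace
open Literature.Analysis.ValidatedNumerics.Numerics
open Summit.AtomisticToContinuum.Crystallization.Theorems.ChargedEnergyGapNegative (E3)
open Summit.AtomisticToContinuum.Crystallization.Theorems.FrustratedLawDichotomyStrainedPatchHomSplit (latPt hexFrame hcpShift)
open Summit.AtomisticToContinuum.Crystallization.Theorems.FrustratedLawDichotomyStrainedPatchHomEntryGram (entryFI mem_entryFI)
open Summit.AtomisticToContinuum.Crystallization.Theorems.FrustratedLawDichotomyStrainedPatchHomEntryGramHcp (dot3 shufFI mem_dot3 mem_shufFI)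
open Summit.AtomisticToContinuum.Crystallization.Theorems.FrustratedLawDichotomyStrainedPatchHomForceKit (vecB mem_vecB)

/-! ## §1. The label list is the index box -/

/-- Membership in `rng15` is `−7 ≤ i ≤ 7`. [formal bookkeeping] -/
theorem mem_rng15 {i : ℤ} : i ∈ rng15 ↔ -7 ≤ i ∧ i ≤ 7 := by
  have h : rng15 = [-7, -6, -5, -4, -3, -2, -1, 0, 1, 2, 3, 4, 5, 6, 7] := by decide
  rw [h]
  simp only [List.mem_cons, List.not_mem_nil, or_false]
  omega

/-- ★ `boxLabels7.toFinset = [−7, 7]³` (the `hver`'s B-family index box). [formal bookkeeping] -/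
theorem boxLabels7_toFinset : boxLabels7.toFinset = Fintype.piFinset fun _ : Fin 3 => Finset.Icc (-7 : ℤ) 7 := by
  ext b
  simp only [List.mem_toFinset, boxLabels7, List.mem_flatMap, List.mem_map, Fintype.mem_piFinset, Finset.mem_Icc]
  constructor
  · rintro ⟨i, hi, j, hj, k, hk, rfl⟩
    rw [mem_rng15] at hi hj hk
    intro t
    fin_cases t
    · simpa using hi
    · simpa using hj
    · simpa using hk
  · intro h
    refine ⟨b 0, mem_rng15.2 (h 0), b 1, mem_rng15.2 (h 1), b 2, mem_rng15.2 (h 2), ?_⟩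
    funext t
    fin_cases t <;> rfl

/-! ## §2. Labels rejected by the near filter are far on the whole box -/

/-- ★ **Rejected ⟹ far**: if `b ∉ nearLabels c w r2n r2d` (`r2d > 0`) then for every `U` with entries in the box and every shuffle `ξ` in the box,
`r2n/r2d ≤ ‖latPt U hexFrame b + U(hcpShift + ξ)‖²`. [folklore] -/
theorem far_of_not_near {c w : (Fin 3 × Fin 3) ⊕ Fin 3 → ℤ} {r2n : ℤ} {r2d : ℕ} (hd : 0 < r2d) {b : Fin 3 → ℤ} (hb7 : b ∈ boxLabels7)
    (hnot : b ∉ nearLabels c w r2n r2d) (U : E3 →L[ℝ] E3) (ξ : E3)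
    (hbox : ∀ ab : Fin 3 × Fin 3, |(U (EuclideanSpace.single ab.2 (1 : ℝ))) ab.1 - (c (Sum.inl ab) : ℝ) / SC| ≤ (w (Sum.inl ab) : ℝ) / SC)
    (hξ : ∀ i : Fin 3, |ξ i - (c (Sum.inr i) : ℝ) / SC| ≤ (w (Sum.inr i) : ℝ) / SC) :
    (r2n : ℝ) / r2d ≤ ‖latPt U hexFrame b + U (hcpShift + ξ)‖ ^ 2 := by
  have hS : (0 : ℝ) < SC := by norm_num [SC]
  -- the filter test failed
  have htest : ¬ ((dot3 (vecB (entryFI (fun ab => c (Sum.inl ab)) (fun ab => w (Sum.inl ab))) (shufFI c w) b)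
      (vecB (entryFI (fun ab => c (Sum.inl ab)) (fun ab => w (Sum.inl ab))) (shufFI c w) b)).lo < (FI.ofFrac r2n r2d).hi) := by
    intro hlt
    apply hnot
    simp only [nearLabels, List.mem_filter, decide_eq_true_eq]
    exact ⟨hb7, hlt⟩
  rw [not_lt] at htest
  set Q := dot3 (vecB (entryFI (fun ab => c (Sum.inl ab)) (fun ab => w (Sum.inl ab))) (shufFI c w) b)
      (vecB (entryFI (fun ab => c (Sum.inl ab)) (fun ab => w (Sum.inl ab))) (shufFI c w) b) with hQdef
  -- memberships
  have hC : ∀ a, FI.mem ((latPt U hexFrame b + U (hcpShift + ξ)) a)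
      (vecB (entryFI (fun ab => c (Sum.inl ab)) (fun ab => w (Sum.inl ab))) (shufFI c w) b a) :=
    fun a => mem_vecB U ξ (fun ab => mem_entryFI (hbox ab)) (fun i => mem_shufFI (hξ i)) b a
  have hQ : FI.mem (‖latPt U hexFrame b + U (hcpShift + ξ)‖ ^ 2) Q := by
    have := mem_dot3 hC hC
    rwa [real_inner_self_eq_norm_sq] at this
  have ht : FI.mem ((r2n : ℝ) / r2d) (FI.ofFrac r2n r2d) := FI.mem_ofFrac r2n hd
  have h1 : (r2n : ℝ) / r2d * SC ≤ (FI.ofFrac r2n r2d).hi := ht.2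
  have h2 : ((FI.ofFrac r2n r2d).hi : ℝ) ≤ (Q.lo : ℝ) := by exact_mod_cast htest
  have h3 : (Q.lo : ℝ) ≤ ‖latPt U hexFrame b + U (hcpShift + ξ)‖ ^ 2 * SC := hQ.1
  exact le_of_mul_le_mul_right (h1.trans (h2.trans h3)) hS

end Summit.AtomisticToContinuum.Crystallization.Theorems.FrustratedLawDichotomyStrainedPatchHomCurvLeaf

end
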